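import Summits.ResolutionOfSingularities.ResolutionOfSingularities.Theorems.WeakOrderReduction
import Literature.AlgebraicGeometry.Resolution.CutkoskySurfaceOrderReduction
import Literature.AlgebraicGeometry.Resolution.QuasiExcellentSchemes
import HarnessLib

/-!
# GenericPointCutClasses — the dim-4 order core cut by the CODIMENSION IN `Y` OF THE IMAGE OF THE TOP LOCUS
(decomp-res node «GenericPointCut», lens-2 g7), route-independent part

Source HOME/decomp-res-lens-2/g7/GenericPointCut.lean (sha256 85d60215dc2b140d, 369 lines; critic `lean check` rc 0,
0 err, 0 warn, 0 sorry, `closes_engines` axioms standard), CRITIC-LEDGER row 49 (2026-08-30T07:15Z): CLEARED AS MAP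
+ CONFINEMENT NODE (residual 0 · decision +2 (one firm = cheap theorem #10 `RoundCodimTwo`, one provisional) · map
+1). This file carries the ROUTE-INDEPENDENT part verbatim (imports: the landed `Theorems.WeakOrderReduction` for
`SeqDimFour` / `E` / `WeakAdmissible` / `WeakResolution` / `ClassGE` BY NAME and the Literature fact file
`CutkoskySurfaceOrderReduction` for the dim-2 engine `Cutkosky2009_rem_6_2`):
* the grading `ConfinedGE f M c` (the top locus lies over points of `Y` of codimension `≥ c`) and the schema
  `ReachConfined I n c` (a FRESH datum admits a weakly admissible history confining its top locus over codimension
  `≥ c`);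
* the three pieces at marking `n`, EXACT by pure logic: `SeqDimFour 1 n ⟺ RoundCodimTwo n ∧ RoundCodimThree n ∧
  ClosedPointCore n` (`seq_iff_rounds`; each piece implied by the target BY LETTER, kernels `*_of_seq`), the
  principal sub-round `RoundCodimThreePrincipal n`, and the honesty kernel `closedPointCore_iff_seq_of_rounds`
  (modulo the rounds the core IS the target: the cut RELOCATES the open problem);
* the typed transversal ENGINES `ExcellentThreefoldOrderReduction` (Cutkosky 2009 Thm. 5.6 without `k = k̄`:
  UNDECIDED, CP-sized, credit 0) and its principal slice `ExcellentThreefoldOrderReductionPrincipal`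
  (Cossart–Jannsen–Saito 2020: KNOWN-MOD-PORT (M)), and the globalisation PORTS `GlobTwo n` / `GlobThree n` /
  `GlobThreePrincipal n` (COSTUME, credit 0 — used as hypotheses only), with `pieces_of_engines`;
* the family kernels `e_one_of_pieces`, `e_one_iff_pieces`, `e_one_iff_families` (EXACT).
The links BY NAME to MaxContactCut (29273 RungOne, 28011, 28544, pocket 27135) live in
`Theorems.MaxContactCutGenericPointCut`.  Grades are codimensions `c ∈ {1,2,3,4}` of image points in a fourfold:
generic points are special (transversal problems of dimension ≤ 3 over IMPERFECT residue fields), closed points are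
generic (the located residual).  Nearest relative: DeepSandwich's `SandwichConfinement` (Temkin, Prop. 2.3.4,
variety level) — this is its EMBEDDED, FIXED-ORDER twin inside the E-ladder.  No statement here is a claim:
definitions + pure-logic kernels; no instances, no notation.  (Temkin 2008 Prop. 2.3.4; Cossart–Jannsen–Saito 2020
Thm. 1.4/6.9; Cutkosky 2009 Thm. 5.6/6.1, Rem. 6.2; Cossart–Piltant 2019 Prop. 4.3/4.4;
Bierstone–Grigoriev–Milman–Włodarczyk 2011 §3.1; EGA IV₂ 7.8.3.)
-/

namespace Summit.ResolutionOfSingularities.ResolutionOfSingularities.Theorems.GenericPointCutClasses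

open CategoryTheory AlgebraicGeometry
open Literature.AlgebraicGeometry.Resolution
open Summit.ResolutionOfSingularities.ResolutionOfSingularities.Theorems
open Summit.ResolutionOfSingularities.ResolutionOfSingularities.Theorems.WeakOrderReduction

/-! ## The grading: codimension in the base of the image of the top locus -/

/-- `ConfinedGE f M c`: every point of the support of the marked ideal `M` on `X` maps under `f : X ⟶ Y` to a point of
`Y` whose local ring has Krull dimension `≥ c` («the top locus lies over points of codimension ≥ c»).  For `c = 4`
on a fourfold: over finitely many CLOSED points.  DEFINITION (support). -/
def ConfinedGE {X Y : Scheme.{0}} (f : X ⟶ Y) (M : MarkedIdeal X) (c : ℕ) : Prop :=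
  ∀ z : X, z ∈ M.support → ((c : ℕ) : WithBot ℕ∞) ≤ ringKrullDim (Y.presheaf.stalk (f.base z))

/-- An empty support is confined over anything. [folklore] -/
theorem confinedGE_of_support_eq_empty {X Y : Scheme.{0}} (f : X ⟶ Y) (M : MarkedIdeal X) (c : ℕ)
    (h : M.support = ∅) : ConfinedGE f M c := by
  intro z hz
  rw [h] at hz
  exact absurd hz (Set.notMem_empty z)

/-- Confinement is monotone in the codimension bound. [folklore] -/
theorem confinedGE_mono {X Y : Scheme.{0}} (f : X ⟶ Y) (M : MarkedIdeal X) {c c' : ℕ} (hcc : c ≤ c')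
    (h : ConfinedGE f M c') : ConfinedGE f M c :=
  fun z hz => le_trans (by exact_mod_cast hcc) (h z hz)

/-- `ReachConfined n c`: the FRESH datum `(Y, I, n)` admits SOME weakly admissible history `t` after which the top
locus `supp(I_t, n)` is confined over points of `Y` of codimension `≥ c`.  (Schema used by the three pieces.) -/
def ReachConfined {Y : Scheme.{0}} (I : Y.IdealSheafData) (n c : ℕ) : Prop :=
  ∃ t : CentreSeq Y, WeakAdmissible t (⟨I, [], n⟩ : MarkedIdeal Y) ∧
    ConfinedGE t.comp (t.transformMarked (⟨I, [], n⟩ : MarkedIdeal Y)) c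

/-- A weak resolution reaches every confinement level (its final support is empty). [folklore] -/
theorem reachConfined_of_weakResolution {Y : Scheme.{0}} (I : Y.IdealSheafData) (n c : ℕ)
    (h : ∃ t : CentreSeq Y, WeakResolution t (⟨I, [], n⟩ : MarkedIdeal Y)) : ReachConfined I n c := by
  obtain ⟨t, hA, hE⟩ := h
  exact ⟨t, hA, confinedGE_of_support_eq_empty _ _ _ hE⟩

/-! ## The three pieces (fresh-data frame = the binders of `WeakOrderReduction.SeqDimFour`) -/

/-- **KNOWN-MOD-PORT · decided round** `RoundCodimTwo n`: every datum `(Y, I, n)` (order ≤ n everywhere) on a regular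
separated finite-type `Y/k`, `dim Y ≤ 4`, admits a weakly admissible history after which the top locus lies over
points of `Y` of codimension ≥ 3.  ENGINE (port, size M): (i) divisorial components `D` of a top locus are REGULAR
(at a top point `I_t ⊆ 𝓘_D^n` and `ord ≤ n` force `ord 𝓘_D = 1`) and are blown up first (controlled transform
divides by `𝓘_D^n`); (ii) over each of the finitely many codimension-2 points `y` of `Y` under the top locus, the
transversal problem is weak order reduction of `(I_y, n)` in the 2-dimensional regular local ring `𝒪_{Y,y}` —
characteristic-free (Hironaka 1977 idealistic exponents in dimension 2; Cossart–Giraud–Orbanz LNM 1101; Lipman1978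
§2), any residue field; (iii) its point centres spread to surfaces in `Y_t`, regularised inside the top locus by
CJS (tree fact `CossartJannsenSaito2020EmbeddedSequenceB`, dim ≤ 2 — the cell's accepted closure device, ERRATUM
#2), its curve centres are divisorial hence regular threefolds by (i); (iv) the image of the top locus in `Y` only
shrinks.  By letter a consequence of `SeqDimFour 1 n` (`roundCodimTwo_of_seq`). (Hironaka1977;
CossartGiraudOrbanz1984; Lipman1978 §2; CossartJannsenSaito2020 Thm 1.4/6.9;
BierstoneGrigorievMilmanWlodarczyk2011 §3.1) -/
def RoundCodimTwo (n : ℕ) : Prop :=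
  ∀ p : ℕ, p.Prime → ∀ (k : Type) [Field k] [CharP k p]
    (Y : Scheme.{0}) (g : Y ⟶ Spec (.of k)), IsSeparated g → LocallyOfFiniteType g → QuasiCompact g →
    Scheme.IsRegular Y → topologicalKrullDim Y ≤ 4 →
    ∀ I : Y.IdealSheafData, (∀ y : Y, idealOrder I y ≤ ((n : ℕ) : ℕ∞)) →
      ReachConfined I n 3

/-- **UNDECIDED (general) · CP-sized, not core-sized** `RoundCodimThree n`: from a stage confined over codimension ≥ 3
reach a stage confined over codimension ≥ 4 (= over finitely many closed points of 4-dimensional local rings).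
The transversal problem at a codimension-3 point `y` is weak order reduction of `(I_y, n)` in the 3-dimensional
regular local ring `𝒪_{Y,y}` whose residue field `κ(y)` (transcendence degree 1 over `k`) is in general IMPERFECT
— lens-5's NonExhausted column (critic rows 34/38: in print only `c = 1`, CossartPiltant2019 Prop. 4.3/4.4, and
principal max-ord over `k̄`, Cutkosky2009 5.1; perfect ground fields arXiv:1103.3464) met at NON-CLOSED points;
closures of its centres have dimension ≤ 2 (CJS) or are divisorial (regular).  TEST T-codim3 (desk: is max-ord
weak order reduction of a marked PENCIL `((x,h), n)` in an excellent regular local ring of dimension 3 with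
imperfect residue field in print?). PRINCIPAL data: KNOWN-MOD-PORT, see `RoundCodimThreePrincipal`.  By letter a
consequence of `SeqDimFour 1 n`. (CossartPiltant2019 Prop 4.3/4.4; Cutkosky2009 Thm 5.1; BenitoVillamayor2012;
CossartJannsenSaito2020) -/
def RoundCodimThree (n : ℕ) : Prop :=
  ∀ p : ℕ, p.Prime → ∀ (k : Type) [Field k] [CharP k p]
    (Y : Scheme.{0}) (g : Y ⟶ Spec (.of k)), IsSeparated g → LocallyOfFiniteType g → QuasiCompact g →
    Scheme.IsRegular Y → topologicalKrullDim Y ≤ 4 →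
    ∀ I : Y.IdealSheafData, (∀ y : Y, idealOrder I y ≤ ((n : ℕ) : ℕ∞)) →
      ReachConfined I n 3 → ReachConfined I n 4

/-- **KNOWN-MOD-PORT · decided sub-round** `RoundCodimThreePrincipal n`: `RoundCodimThree n` for locally PRINCIPAL `I`
(hypersurface data).  ENGINE: at a codimension-3 point `y` under the top locus the transversal datum is a
hypersurface germ `V(h_y)` of multiplicity `n` in regular excellent local schemes of dimension 3; for
hypersurfaces the Hilbert–Samuel function IS the multiplicity, so the CJS canonical sequence for the 2-dimensional
scheme `V(h)` (tree fact `CossartJannsenSaito2020EmbeddedSequenceB`, ambient regular excellent of any dimension)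
has all centres inside the max-HS locus = top locus `{ord h = n}` (weakly admissible; controlled = strict
transform there) and ends with the multiplicity, i.e. the order, below `n` over `y`; divisorial (non-reduced)
factors are regular and divided out first; closures regularised by CJS in `Y_t`.  Port size M.  TEST T-cjs-scope
(desk): CJS Thm 1.4 is stated for REDUCED `X` — check the reduction of a non-reduced hypersurface germ `h =
f₁^{m₁}⋯` to the reduced case via (i) of `RoundCodimTwo`. (CossartJannsenSaito2020 Thm 1.4, Thm 6.9 (a);
BierstoneGrigorievMilmanWlodarczyk2011 §3.1) -/
def RoundCodimThreePrincipal (n : ℕ) : Prop :=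
  ∀ p : ℕ, p.Prime → ∀ (k : Type) [Field k] [CharP k p]
    (Y : Scheme.{0}) (g : Y ⟶ Spec (.of k)), IsSeparated g → LocallyOfFiniteType g → QuasiCompact g →
    Scheme.IsRegular Y → topologicalKrullDim Y ≤ 4 →
    ∀ I : Y.IdealSheafData, (∀ y : Y, idealOrder I y ≤ ((n : ℕ) : ℕ∞)) →
      (∀ y : Y, ∃ U : Y.affineOpens, y ∈ (U : Y.Opens) ∧ ∃ h : Γ(Y, U), I.ideal U = Ideal.span {h}) →
      ReachConfined I n 3 → ReachConfined I n 4

/-- **UNDECIDED · THE LOCATED RESIDUAL · IDEA-NEEDED** `ClosedPointCore n`: a datum `(Y, I, n)` which admits a weakly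
admissible history confining its top locus over CLOSED points (codimension ≥ 4, finitely many) admits a weak
resolution.  This is the dim-4 order core seen through the cut: everything the lower-dimensional transversal
theories can do has been done; what is left lives in finitely many closed fibres — the E-form twin of
DeepSandwich's `PointSandwichResolve` / `FibreBoundedResolve` (25833 / 26947, variety level) and the arena of
lens-4's `ForcedTowersTerminate` (g7).  Combined with TauLadder (tree `MaxContactCut.RungFour…RungOne`) the open
part is: closed contact-free τ = 1 top points in closed fibres.  INSTRUMENTS T-confine-1/2 (NODE-g7.md).  By
letter a consequence of `SeqDimFour 1 n` (`closedPointCore_of_seq`); inherits every barrier of the core.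
(arXiv:math/0703678 Prop 2.3.4; CossartPiltant2019; BierstoneGrigorievMilmanWlodarczyk2011 §3.1) -/
def ClosedPointCore (n : ℕ) : Prop :=
  ∀ p : ℕ, p.Prime → ∀ (k : Type) [Field k] [CharP k p]
    (Y : Scheme.{0}) (g : Y ⟶ Spec (.of k)), IsSeparated g → LocallyOfFiniteType g → QuasiCompact g →
    Scheme.IsRegular Y → topologicalKrullDim Y ≤ 4 →
    ∀ I : Y.IdealSheafData, (∀ y : Y, idealOrder I y ≤ ((n : ℕ) : ℕ∞)) →
      ReachConfined I n 4 → ∃ t : CentreSeq Y, WeakResolution t (⟨I, [], n⟩ : MarkedIdeal Y)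

/-- The three pieces at marking `n`, bundled. -/
def Pieces (n : ℕ) : Prop := RoundCodimTwo n ∧ RoundCodimThree n ∧ ClosedPointCore n

/-! ## Kernels — pure logic -/

/-- Class ≥ 1 is no condition. [folklore] -/
theorem classGE_one {k : Type} [Field k] {Y : Scheme.{0}} (g : Y ⟶ Spec (.of k)) (hY : Scheme.IsRegular Y)
    (I : Y.IdealSheafData) (n : ℕ) (y : Y) : ClassGE g hY I n 1 y :=
  Or.inl le_rfl

/-- **ASSEMBLY**: the two rounds and the closed-point core give weak order reduction for ALL dim-4 data at marking
`n`. [folklore] -/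
theorem seq_of_rounds {n : ℕ} (h2 : RoundCodimTwo n) (h3 : RoundCodimThree n) (hC : ClosedPointCore n) :
    SeqDimFour 1 n := by
  intro p hp k _ _ Y g hg1 hg2 hg3 hY hY4 I hord _
  exact hC p hp k Y g hg1 hg2 hg3 hY hY4 I hord
    (h3 p hp k Y g hg1 hg2 hg3 hY hY4 I hord (h2 p hp k Y g hg1 hg2 hg3 hY hY4 I hord))

/-- By letter: the target gives the first round (a weak resolution is confined over anything). [folklore] -/
theorem roundCodimTwo_of_seq {n : ℕ} (h : SeqDimFour 1 n) : RoundCodimTwo n := by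
  intro p hp k _ _ Y g hg1 hg2 hg3 hY hY4 I hord
  exact reachConfined_of_weakResolution I n 3
    (h p hp k Y g hg1 hg2 hg3 hY hY4 I hord fun y _ => classGE_one g hY I n y)

/-- By letter: the target gives the second round. [folklore] -/
theorem roundCodimThree_of_seq {n : ℕ} (h : SeqDimFour 1 n) : RoundCodimThree n := by
  intro p hp k _ _ Y g hg1 hg2 hg3 hY hY4 I hord _
  exact reachConfined_of_weakResolution I n 4
    (h p hp k Y g hg1 hg2 hg3 hY hY4 I hord fun y _ => classGE_one g hY I n y)

/-- By letter: the target gives the closed-point core. [folklore] -/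
theorem closedPointCore_of_seq {n : ℕ} (h : SeqDimFour 1 n) : ClosedPointCore n := by
  intro p hp k _ _ Y g hg1 hg2 hg3 hY hY4 I hord _
  exact h p hp k Y g hg1 hg2 hg3 hY hY4 I hord fun y _ => classGE_one g hY I n y

/-- **EXACTNESS** of the cut at every marking: no piece exceeds the target by letter, and together they are it.
[folklore] -/
theorem seq_iff_rounds (n : ℕ) : SeqDimFour 1 n ↔ Pieces n :=
  ⟨fun h => ⟨roundCodimTwo_of_seq h, roundCodimThree_of_seq h, closedPointCore_of_seq h⟩,
    fun h => seq_of_rounds h.1 h.2.1 h.2.2⟩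

/-- The principal sub-round is a sub-case of the general second round. [folklore] -/
theorem roundCodimThreePrincipal_of_roundCodimThree {n : ℕ} (h : RoundCodimThree n) :
    RoundCodimThreePrincipal n := by
  intro p hp k _ _ Y g hg1 hg2 hg3 hY hY4 I hord _ hR
  exact h p hp k Y g hg1 hg2 hg3 hY hY4 I hord hR

/-- LATTICE: modulo the two rounds, the closed-point core IS the target (the cut relocates, it does not shrink, the
open problem — stated so that the critic need not discover it). [folklore] -/
theorem closedPointCore_iff_seq_of_rounds {n : ℕ} (h2 : RoundCodimTwo n) (h3 : RoundCodimThree n) :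
    ClosedPointCore n ↔ SeqDimFour 1 n :=
  ⟨fun hC => seq_of_rounds h2 h3 hC, closedPointCore_of_seq⟩

/-! ## The transversal ENGINES (typed) and the globalisation PORTS (costume by shape)

The decided rounds are «local engine at the non-closed point» + «globalisation».  The dim-2 engine is the tree's
NAMED FACT `Cutkosky2009_rem_6_2` (Cutkosky2009 Thm 6.1 + Rem 6.2: weak order reduction at marking `r ≥ max-ord` for
ANY marked ideal on `Spec A`, `A` an excellent regular local ring of dimension 2 containing a field — exactly
`𝒪_{Y,η}` at a codimension-2 point `η`; the preceding steps of the round are isomorphisms over `Spec 𝒪_{Y,η}`).  The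
dim-3 engine in the generality the second round needs is NOT in print (Cutkosky2009 Thm 5.6 = tree
`Cutkosky2009_thm_5_6` wants an algebraically closed ground field; CossartPiltant2019 Prop 4.3/4.4 is marking 1;
arXiv:1103.3464 perfect fields) — typed below as `ExcellentThreefoldOrderReduction` (UNDECIDED, T-codim3); its
PRINCIPAL slice is CJS 2020 (KNOWN-MOD-PORT). -/

/-- **ENGINE · UNDECIDED (T-codim3) · CP-sized** `ExcellentThreefoldOrderReduction`: Cutkosky's Theorem 5.6 WITHOUT
the algebraically closed ground field — for every noetherian regular EXCELLENT scheme `W` of dimension ≤ 3 over a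
field of characteristic `p` (no finite-type hypothesis: the schemes `Y_t ×_Y Spec 𝒪_{Y,η}` over a codimension-3
point `η` are of this kind, residue fields of transcendence degree 1 over `k`, imperfect), every snc boundary `E`,
every ideal sheaf `I ≠ 0` and every `r ≥ 1` with `ord_x I ≤ r` everywhere, the marked ideal `(I, E, r)` admits a
marked resolution (tree `IsMarkedResolution`).  In print: `k̄` quasi-projective (Cutkosky2009 5.6), `r = 1`
(CossartPiltant2019 4.3/4.4), principal `I` (CJS 2020, next decl), perfect f.t. (arXiv:1103.3464).  Not a
consequence of the target by letter (engine statement, like the X1 port 28616); booked as the CP-sized rung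
feeding `RoundCodimThree` through `GlobThree`. (Cutkosky2009 Thm 5.6, Thm 6.1, Rem 6.2; CossartPiltant2019 Prop
4.3/4.4; BenitoVillamayor2012) -/
def ExcellentThreefoldOrderReduction : Prop :=
  ∀ p : ℕ, p.Prime → ∀ (k : Type) [Field k] [CharP k p] (W : Scheme.{0}) [IsNoetherian W] (_g : W ⟶ Spec (.of k)),
    Scheme.IsRegular W → Scheme.IsExcellent W → topologicalKrullDim W ≤ 3 →
    ∀ (E : List W.IdealSheafData), HasSNC E →
    ∀ (I : W.IdealSheafData), I ≠ ⊥ → ∀ (r : ℕ), 1 ≤ r → (∀ x : W, idealOrder I x ≤ r) →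
      ∃ (W' : Scheme.{0}) (π : W' ⟶ W) (R' : MarkedIdeal W'), IsMarkedResolution (⟨I, E, r⟩ : MarkedIdeal W) π R'

/-- **ENGINE · KNOWN-MOD-PORT (M)** `ExcellentThreefoldOrderReductionPrincipal`: the principal slice — `I` locally
principal (hypersurface data).  CJS 2020: for the 2-dimensional closed subscheme `X = V(h) ⊂ W` the Hilbert–Samuel
function at a point is determined by `(dim W, ord h)`, the canonical sequence eliminating the maximal
Hilbert–Samuel stratum `X_max = {ord h = r}` (book p.84 (ME1): permissible blow-ups, isomorphism over `X − X_max`,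
`Σ_{X'} ∩ Σ_X^max = ∅`; Thm 6.6/6.9 allow non-reduced `X`, p.11; Ch.16) is a sequence of blow-ups in regular
centres inside the top locus along which `h` is normally flat, so total transform = `𝓘_exc^r ·` strict transform =
controlled transform, ending with `ord < r` everywhere.  Port M: HS ↔ multiplicity for hypersurfaces
(Herrmann–Ikeda–Orbanz 1988), snc bookkeeping of the boundary (CJS Thm 6.9 is the boundary version), packaging as
`IsMarkedResolution`. (CossartJannsenSaito2020 Thm 1.4, Thm 6.9, (ME1); HerrmannIkedaOrbanz1988) -/
def ExcellentThreefoldOrderReductionPrincipal : Prop :=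
  ∀ p : ℕ, p.Prime → ∀ (k : Type) [Field k] [CharP k p] (W : Scheme.{0}) [IsNoetherian W] (_g : W ⟶ Spec (.of k)),
    Scheme.IsRegular W → Scheme.IsExcellent W → topologicalKrullDim W ≤ 3 →
    ∀ (E : List W.IdealSheafData), HasSNC E →
    ∀ (I : W.IdealSheafData), I ≠ ⊥ → ∀ (r : ℕ), 1 ≤ r → (∀ x : W, idealOrder I x ≤ r) →
      (∀ x : W, ∃ U : W.affineOpens, x ∈ (U : W.Opens) ∧ ∃ h : Γ(W, U), I.ideal U = Ideal.span {h}) →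
      ∃ (W' : Scheme.{0}) (π : W' ⟶ W) (R' : MarkedIdeal W'), IsMarkedResolution (⟨I, E, r⟩ : MarkedIdeal W) π R'

/-- The principal slice is a sub-case of the general engine. [folklore] -/
theorem excellentThreefoldOrderReductionPrincipal_of (h : ExcellentThreefoldOrderReduction) :
    ExcellentThreefoldOrderReductionPrincipal := by
  intro p hp k _ _ W _ g hW hexc hW3 E hE I hI r hr hord _
  exact h p hp k W g hW hexc hW3 E hE I hI r hr hord

/-- **PORT · COSTUME(cite) · KNOWN-MOD-PORT (M)** `GlobTwo n`: the dim-2 engine (tree named fact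
`Cutkosky2009_rem_6_2`) gives the first round.  Content of the port: (i) divisorial top components are regular
(regular local rings are UFDs: `I ⊆ (f^n)` + `ord ≤ n` ⇒ `ord f = 1`) and are divided out by blowing them up (iso);
(ii) at a codimension-2 point `η` under the top locus the earlier steps are isomorphisms over `Spec 𝒪_{Y,η}` (centres
over other codim-2 points or over codim ≥ 3 sets miss the fibre), `𝒪_{Y,η}` is excellent regular local of dimension 2
containing `k` and `I_η ≠ 0` (else `ord = ⊤ > n` nearby), so `Cutkosky2009_rem_6_2` gives a marked (hence weak)
resolution of `(I_η, ∅, n)`; (iii) its centres spread (EGA IV₃ §8) to closures in `Y_t` — points ↦ surfaces,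
regularised by blow-ups INSIDE the top locus over codim ≥ 3 sets (CJS Cor 1.5 = tree
`CossartJannsenSaito2020EmbeddedSequenceB`), curves ↦ divisors, regular by (i); flat base change of blow-ups
(EGA IV₂ §2) identifies the local transform; (iv) order never increases (char-free), the set of codim-≤2 image points
is finite and loses `η` without gaining members ⇒ induction.  Sources: Cutkosky2009 Thm 6.1/Rem 6.2 (p19–20);
CossartJannsenSaito2020 Cor 1.5; EGA IV₂ 2.x, IV₃ 8.x; BierstoneGrigorievMilmanWlodarczyk2011 §3.1. -/
def GlobTwo (n : ℕ) : Prop := Cutkosky2009_rem_6_2.{0} → RoundCodimTwo n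

/-- **PORT · COSTUME(cite)** `GlobThree n`: the dim-3 engine gives the second round — same globalisation as `GlobTwo`
one codimension up (point centres ↦ curves, curve centres ↦ surfaces, both CJS-regularised inside the top locus over
closed points; surface centres ↦ divisors, regular), applied to `W = Y_t ×_Y Spec 𝒪_{Y,η}` over each of the finitely
many codimension-3 points `η` under the (already codim-≥3-confined) top locus; `W` is noetherian regular excellent of
dimension 3 over `k` (proper over `Spec 𝒪_{Y,η}`), which is why the engine is typed without finite type. -/
def GlobThree (n : ℕ) : Prop := ExcellentThreefoldOrderReduction → RoundCodimThree n

/-- **PORT · COSTUME(cite)** `GlobThreePrincipal n`: the CJS engine gives the principal second round (controlled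
transforms of a principal ideal stay principal along the history). -/
def GlobThreePrincipal (n : ℕ) : Prop := ExcellentThreefoldOrderReductionPrincipal → RoundCodimThreePrincipal n

/-- ENGINE LEDGER: the whole cut from the two engines, the two ports and the closed-point core. [folklore] -/
theorem pieces_of_engines {n : ℕ} (e2 : Cutkosky2009_rem_6_2.{0}) (g2 : GlobTwo n)
    (e3 : ExcellentThreefoldOrderReduction) (g3 : GlobThree n) (hC : ClosedPointCore n) : Pieces n :=
  ⟨g2 e2, g3 e3, hC⟩


/-! ## The family over all markings and `E 1` (route-independent) -/

/-- The family over all markings gives `E 1`. [folklore] -/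
theorem e_one_of_pieces (h : ∀ n : ℕ, 1 ≤ n → Pieces n) : E 1 :=
  fun n hn => (seq_iff_rounds n).mpr (h n hn)

/-- Conversely `E 1` gives every piece at every marking (EXACT at the family level). [folklore] -/
theorem e_one_iff_pieces : E 1 ↔ ∀ n : ℕ, 1 ≤ n → Pieces n :=
  ⟨fun h n hn => (seq_iff_rounds n).mp (h n hn), e_one_of_pieces⟩

/-- `E 1` is EQUIVALENTLY the three families (rounds and core quantified over all markings `n ≥ 1`). [folklore] -/
theorem e_one_iff_families : E 1 ↔ (∀ n : ℕ, 1 ≤ n → RoundCodimTwo n) ∧ (∀ n : ℕ, 1 ≤ n → RoundCodimThree n) ∧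
    (∀ n : ℕ, 1 ≤ n → ClosedPointCore n) :=
  ⟨fun h => ⟨fun n hn => ((seq_iff_rounds n).mp (h n hn)).1, fun n hn => ((seq_iff_rounds n).mp (h n hn)).2.1,
      fun n hn => ((seq_iff_rounds n).mp (h n hn)).2.2⟩,
    fun h n hn => seq_of_rounds (h.1 n hn) (h.2.1 n hn) (h.2.2 n hn)⟩

end Summit.ResolutionOfSingularities.ResolutionOfSingularities.Theorems.GenericPointCutClasses
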